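import Summits.QuantumFields.QCD.Theses.NestedDissectionSea
import Summits.QuantumFields.QCD.Theses.HeavyThresholdYMBridge
import Summits.QuantumFields.QCD.Theses.AdaptiveBlockFermions
import Literature.MathematicalPhysics.QuantumFieldTheory.BlockScaleEffectivePerturbation
import HarnessLib.Audit

/-!
# Line `soft-absorption-balaban-cone` — checked skeleton for crux stmt-QuantumFields-13897
(`Summit.QuantumFields.QCD.Theses.NestedDissectionSea.RobustYangMills`, rev 4; shared verbatim with
`HeavyThresholdYMBridge.RobustYangMills` and `AdaptiveBlockFermions.RobustYangMills`)

Crux-plan seat `planner-cruxplan-stmt-QuantumFields-13897-soft-absorption-bala-0`, 2026-08-16, from the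
crux idea card `Cruxes/RobustYangMills/Ideas/soft-absorption-balaban-cone.md` (ideator 2) and the triage
notes TRIAGE-r1-{1,2,3} (all pass). Line card: `Lines/soft-absorption-balaban-cone.md`.

## The crux

`RobustYangMills = ∃ η₀ > 0, ∃ κ ≥ 0, Body η₀ κ` (§0, `robustYangMills_iff : … ↔ … := Iff.rfl`): along
every scaling sequence and every `N_f = 0` two-loop a.f. coupling sequence, for every block scale `ℓ₀` and
every family `W` of bounded quasi-local perturbations eventually admissible — (h1) lattice symmetric,
(h2) reflection positive, (h3) `‖W‖_{b_k,κ} ≤ η₀ g²(ℓ₀)/2`, (h4) range controlled (`AdmAt`) — the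
perturbed theories have (i′) a subsequential OS limit, (ii) non-trivial non-Gaussian gapped, (iii′) a
uniform lattice gap, (iv) Lipschitz response (`Concl`).

## The line in one paragraph

W is ROUGH (measurable, sup-small) while every 4-d Yang–Mills UV technology speaks ANALYTIC activities on
complex small-field domains.  CONDITIONING is the one operation under which roughness disappears at no cost
in analyticity radius: block the fine field to scale `ℓ₀` by a gauge-covariant averaging whose LAST step is
soft (a heat-kernel smear `p_t`, `t = θ g²(ℓ₀)`, of each block link), and absorb the bounded spectator
`e^{-W}` into the block theory, `e^{-W^eff(V)} := E[e^{-W} | V]`.  Holomorphy under the integral sign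
(`stub_holomorphicAbsorption`) makes `V ↦ E[F e^{-W} | V]` analytic on a `W`-independent complex strip of
width `≍ √t ≍ √θ g(ℓ₀)` for ANY bounded measurable `F`; the complex-weights lemma keeps it away from `0`;
the conditional cluster expansion of the soft-conditioned Wilson measure (the W-free Yang–Mills-UV input)
makes `W^eff` a small analytic quasi-local block perturbation in Bałaban's format on small fields, with
never-expanded lumps on collared large-field regions (`SoftScheme.AbsorbsAll`, two-tier `InAbsFormat`).
The crux then follows from robust Yang–Mills for the ANALYTICALLY ABSORBABLE cone (`RobustYangMillsRG♭`,
conjunct (B) of `LineBodyAt`): the block theory is `[Bałaban-format blocked Wilson] ⊕ [analytic O(η g²)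
perturbation]`, an admissible initial condition of his induction from scale `ℓ₀`; the marginal component is
absorbed by attraction to the parabolic centre-unstable curve (`β' → β''`, `Λ' → Λ''`), the infrared end is
that of the unperturbed theory (`stub_wilsonCore`, the Clay core — Disproof.lean §5 proves the crux
implies it, so it is a necessary conjunct shared by every line).

## Stubs (registered) and composition

* `stub_holomorphicAbsorption` — pure analysis, provable now (Cauchy estimates + dominated derivative).
* `stub_wilsonCore` — `W ≡ 0`: Clay `SU(3)` + β-universality along all a.f. sequences (= Disproof §5
  `WilsonConsequences`, ∀ data).
* `stub_softAbsorptionUV` — THE LINE: for every window `ℓ₀Λ' ≤ c_UV`, a family of soft schemes exists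
  (Bałaban's averaging at the weak-coupling threshold scale `ℓ₀' = c_⋆/Λ'` with a heat-kernel last step;
  a perturbation at scale `ℓ₀ ≥ ℓ₀'` is re-indexed at scale `ℓ₀'`, polymer sizes growing by the bounded
  factor `(c_UV/c_⋆)⁴` paid by the fine decay `κ`) which (A) ABSORBS ALL sup-small range-controlled
  perturbations [W-free UV input] and (B) transfers: every lattice-symmetric, reflection-positive family that
  is absorbable WITH INSERTIONS satisfies the conclusion block [`RobustYangMillsRG♭`].  (B) omits (h3)/(h4):
  an uninformative scheme (`p ≡ 1`) absorbs everything trivially but then (B) is refuted by the disprover's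
  mixture witness (Disproof §4) — so only informative schemes can witness the stub, for which (A) is the
  genuine conditional-UV-stability input and (B) the genuine transfer.
* `stub_infraredTail` — the crux body on the tail `ℓ₀Λ' > c_IR`, conditional on the core (blocks beyond the
  correlation length: a polymer expansion in `e^{-W_X} - 1` around the core's clustering measure, NOT a soft
  scheme — at super-correlation scales every averaging is uninformative, so an "absorbable-cone transfer" would be
  false there; HAND-OFF to the gap / certificate lines, triage r1-3).  The tail cannot be reached from the UV stub
  because `η₀, κ` are chosen before `ℓ₀`.
* `RobustYangMills_of : stub₁ → stub₂ → stub₃ → stub₄ → RobustYangMills` is sorry-free logic: constants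
  `κ₀ = max κ_UV κ'`, `η₀ = min (η₁/C, ε₀/2, η₀')`; regime split at `c_IR`; on the window admissible ⇒
  analytically absorbable pointwise in `k` (`hypAt_of_admAt`: `NormLE.add`, range control of sums,
  `AbsorbsAll`) ⇒ conclusions read back (`concl_mono`, antitone in the comparison predicate and in `κ`); on the
  tail `admAt_mono` + `BodyOn` + `concl_mono`.
  `RobustYangMills_skeleton : RobustYangMills` applies it to the four sorried stubs.

Disproof used: §4 `robustYangMillsNoSmall_false` ((h3) load-bearing — here (h3)+(h4) are consumed exactly
once, in `hypAt_of_admAt`, to enter the absorbable cone; and (B) is policed by the same witness); §5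
`robustYangMills_imp_wilson` (the core is necessary: `stub_wilsonCore`); §0b (the whole-torus polymer passes
(h4): the format's `e^{κ₁|Y|}` weights, uniform in the volume, are what exclude global activities after
absorption).  Negatives index (MultibosonBridge ×2, AdaptiveCoarseSystem, DiagonalMirrorRP): untouched.
-/

noncomputable section

namespace Summit.QuantumFields.QCD.Cruxes.RobustYangMills.SoftAbsorptionBalabanCone

open scoped BigOperators Topology ENNReal
open Filter MeasureTheory
open Literature.MathematicalPhysics.QuantumLattice Literature.MathematicalPhysics.AQFT
  Literature.MathematicalPhysics.QuantumFieldTheory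

/-! ### §0 Packaging of the crux (verbatim pieces; `Iff.rfl` against the route decl) -/

/-- The structure group of the crux. -/
abbrev SU3 : Type := ↥(Matrix.specialUnitaryGroup (Fin 3) ℂ)

/-- Its fundamental representation. -/
abbrev ρ₃ : SU3 →* Matrix (Fin 3) (Fin 3) ℂ := fundamentalRep (Fin 3)

/-- The lattice representation record of the crux (`r₃`). -/
def r₃ : LatticeRep SU3 :=
  ⟨3, ρ₃, continuous_fundamentalRep _, fundamentalRep_injective _, fundamentalRep_mem_unitaryGroup⟩

/-- A family of fine-lattice quasi-local perturbations indexed by the step `k` and the torus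
half-side `S` (torus `2S+1`, block size `b_k = ⌊ℓ₀ / a_k⌋`), as quantified in the crux. -/
abbrev Family (a : ℕ → ℝ) (ℓ₀ : ℝ) : Type :=
  (k : ℕ) → (S : ℕ) → QuasiLocalGaugePerturbation 4 (2 * S + 1) SU3 ⌊ℓ₀ / a k⌋₊

/-- **Admissibility at step `k`** — VERBATIM the predicate `AdmAt W k` of the crux with budget
`η₀ / max 1 (afBeta 0 Λ' ℓ₀)` and decay `κ`: for all `S ≥ L_k`, (h1) lattice symmetry of the total,
(h2) reflection positivity, (h3) weighted sup-norm smallness, (h4) range control. -/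
def AdmAt (η₀ κ : ℝ) (a : ℕ → ℝ) (L : ℕ → ℕ) (β' : ℕ → ℝ) (Λ' ℓ₀ : ℝ) (W : Family a ℓ₀) (k : ℕ) : Prop :=
  ∀ S : ℕ, L k ≤ S → (∀ (v : Site 4 (2 * S + 1)) (U : GaugeConfig 4 (2 * S + 1) SU3), (W k S).total (torusConfigShift v U) = (W k S).total U) ∧ (∀ U : GaugeConfig 4 (2 * S + 1) SU3, (W k S).total (GaugeConfig.timeReflect U) = (W k S).total U) ∧ (∀ (π : Equiv.Perm (Fin 4)) (U : GaugeConfig 4 (2 * S + 1) SU3), (W k S).total (fun e => U (e.1 ∘ π, π.symm e.2)) = (W k S).total U) ∧ (W k S).IsReflectionPositive ρ₃ (β' k) ∧ (W k S).NormLE κ (η₀ / max 1 (afBeta 0 Λ' ℓ₀)) ∧ (∀ X : Finset (Site 4 (2 * S + 1)), X ∈ polymers ⌊ℓ₀ / a k⌋₊ → (∃ U : GaugeConfig 4 (2 * S + 1) SU3, (W k S).act X U ≠ 0) → ∀ y ∈ X, ∀ y' ∈ X, ∀ i : Fin 4, (y i - y' i).val ≤ ⌊ℓ₀ / a k⌋₊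 * X.card ∨ (y' i - y i).val ≤ ⌊ℓ₀ / a k⌋₊ * X.card)

/-- **The conclusion block of the crux for the family `W`** — VERBATIM clauses (i′) subsequential
OS limit, (ii) non-triviality / non-Gaussianity / `HasMassGap`, (iii′) uniform lattice clustering,
(iv) Lipschitz response — with the admissibility predicate of the comparison family `W'` in (iv)
abstracted as the parameter `P` (the crux has `P := AdmAt η₀ κ …`; the line's regime stubs have the
analytic-absorbability predicate `HypAt …` instead) and the decay rate `κ` of (iv) as a parameter. -/
def Concl (a : ℕ → ℝ) (L : ℕ → ℕ) (ha : ∀ k, 0 < a k) (ha₀ : Filter.Tendsto a Filter.atTop (nhds 0))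
    (haL : Filter.Tendsto (fun k => a k * L k) Filter.atTop Filter.atTop) (β' : ℕ → ℝ) (ℓ₀ κ : ℝ)
    (P : Family a ℓ₀ → ℕ → Prop) (W : Family a ℓ₀) : Prop :=
  ∃ φ : ℕ → ℕ, StrictMono φ ∧ ∃ (c m : YMSpecies SU3 → ℕ → ℝ) (T : OSData (YMSpecies SU3) 4) (Δ : ℝ), 0 < Δ ∧ (∀ n : ℕ, n ≠ 0 → ∀ (σ : Fin n → YMSpecies SU3) (f : Fin n → SchwartzMap (EuclideanSpace ℝ (Fin 4)) ℝ) (F : SchwartzMap (Fin n → EuclideanSpace ℝ (Fin 4)) ℂ), IsTensorOf F (fun i => ofRealTest (f i)) → IsOffDiagonal F → Filter.Tendsto (fun j : ℕ => ((perturbedLatticeSchwinger ρ₃ (⟨a, ha, ha₀, β', L, haL, c, m⟩ : SpeciesScheme (YMSpecies SU3)) (fun k => W k (L k)) (fun s => s.F) (φ j) n σ f : ℝ) : ℂ)) Filter.atTop (nhds (T.schwinger n σ F))) ∧ T.IsNontrivial r₃.curvature ∧ T.IsNonGaussian r₃.curvature ∧ T.HasMassGap Δ ∧ (∀ A B : YMSpecies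 SU3, ∃ C : ℝ, ∀ᶠ k in Filter.atTop, ∀ S : ℕ, L k ≤ S → ∀ n : ℕ, n ≤ S → |(W k S).connectedCorr ρ₃ (β' k) A.F B.F n| ≤ C * Real.exp (-(Δ * (a k * n)))) ∧ (∀ (n : ℕ) (σ : Fin n → YMSpecies SU3) (f : Fin n → SchwartzMap (EuclideanSpace ℝ (Fin 4)) ℝ), ∃ C : ℝ, ∀ᶠ k in Filter.atTop, ∀ W', P W' k → ∀ δ : ℝ, 0 ≤ δ → (∀ S : ℕ, L k ≤ S → (W k S - W' k S).NormLE κ δ) → |perturbedLatticeSchwinger ρ₃ (⟨a, ha, ha₀, β', L, haL, c, m⟩ : SpeciesScheme (YMSpecies SU3)) (fun k => W k (L k)) (fun s => s.F) k n σ f - perturbedLatticeSchwinger ρ₃ (⟨a, ha, ha₀, β', L, haL, c, m⟩ : SpeciesScheme (YMSpecies SU3)) (fun k => W' k (L k)) (fun s => s.F) k n σ f| ≤ C * δ)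

/-- **The crux body with constants `(η₀, κ)`**: for all scaling data, every `N_f = 0` two-loop
a.f. coupling sequence, every block scale `ℓ₀ > 0` and every eventually admissible family `W`, the
conclusion block (with `P := AdmAt` in clause (iv)). -/
def Body (η₀ κ : ℝ) : Prop :=
  ∀ (a : ℕ → ℝ) (L : ℕ → ℕ) (ha : ∀ k, 0 < a k) (ha₀ : Filter.Tendsto a Filter.atTop (nhds 0))
    (haL : Filter.Tendsto (fun k => a k * L k) Filter.atTop Filter.atTop) (β' : ℕ → ℝ) (Λ' : ℝ),
    0 < Λ' → Filter.Tendsto (fun k => β' k - afBeta 0 Λ' (a k)) Filter.atTop (nhds 0) →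
      ∀ ℓ₀ : ℝ, 0 < ℓ₀ → ∀ W : Family a ℓ₀, (∀ᶠ k in Filter.atTop, AdmAt η₀ κ a L β' Λ' ℓ₀ W k) →
        Concl a L ha ha₀ haL β' ℓ₀ κ (AdmAt η₀ κ a L β' Λ' ℓ₀) W

/-- The crux, re-read through the packaging (definitional: `Iff.rfl`). -/
theorem robustYangMills_iff :
    Summit.QuantumFields.QCD.Theses.NestedDissectionSea.RobustYangMills ↔
      ∃ η₀ : ℝ, 0 < η₀ ∧ ∃ κ : ℝ, 0 ≤ κ ∧ Body η₀ κ :=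
  Iff.rfl

/-- **Monotonicity of the conclusion block** (used to read the regime stubs back): clause (iv) is
antitone in the admissibility predicate of the comparison family and in the decay rate — if eventually
every `Q`-family is a `P`-family and `κ ≤ κ'`, conclusions with `(P, κ)` give conclusions with `(Q, κ')`
(a difference `κ'`-small is `κ`-small, `NormLE.anti`). Clauses (i′)–(iii′) do not mention either. -/
theorem concl_mono {a : ℕ → ℝ} {L : ℕ → ℕ} {ha : ∀ k, 0 < a k} {ha₀ : Filter.Tendsto a Filter.atTop (nhds 0)}
    {haL : Filter.Tendsto (fun k => a k * L k) Filter.atTop Filter.atTop} {β' : ℕ → ℝ} {ℓ₀ κ κ' : ℝ}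
    {P Q : Family a ℓ₀ → ℕ → Prop} {W : Family a ℓ₀} (hκ : κ ≤ κ')
    (hPQ : ∀ᶠ k in Filter.atTop, ∀ W', Q W' k → P W' k) (h : Concl a L ha ha₀ haL β' ℓ₀ κ P W) :
    Concl a L ha ha₀ haL β' ℓ₀ κ' Q W := by
  obtain ⟨φ, hφ, c, m, T, Δ, hΔ, h1, h2, h3, h4, h5, h6⟩ := h
  refine ⟨φ, hφ, c, m, T, Δ, hΔ, h1, h2, h3, h4, h5, fun n σ f => ?_⟩
  obtain ⟨C, hC⟩ := h6 n σ f
  refine ⟨C, ?_⟩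
  filter_upwards [hC, hPQ] with k hk hkey W' hW' δ hδ hS
  exact hk W' (hkey W' hW') δ hδ fun S hS' => (hS S hS').anti hκ

/-- Admissibility is antitone in the decay rate (only (h3) mentions `κ`). -/
theorem admAt_anti {η₀ κ κ' : ℝ} {a : ℕ → ℝ} {L : ℕ → ℕ} {β' : ℕ → ℝ} {Λ' ℓ₀ : ℝ} {W : Family a ℓ₀}
    {k : ℕ} (hκ : κ ≤ κ') (h : AdmAt η₀ κ' a L β' Λ' ℓ₀ W k) : AdmAt η₀ κ a L β' Λ' ℓ₀ W k := by
  intro S hS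
  obtain ⟨h1, h2, h3, h4, h5, h6⟩ := h S hS
  exact ⟨h1, h2, h3, h4, h5.anti hκ, h6⟩

/-- The crux body RESTRICTED TO A REGIME of the block scale (`Regime Λ' ℓ₀`), with constants `(η₀, κ)`. -/
def BodyOn (Regime : ℝ → ℝ → Prop) (η₀ κ : ℝ) : Prop :=
  ∀ (a : ℕ → ℝ) (L : ℕ → ℕ) (ha : ∀ k, 0 < a k) (ha₀ : Filter.Tendsto a Filter.atTop (nhds 0))
    (haL : Filter.Tendsto (fun k => a k * L k) Filter.atTop Filter.atTop) (β' : ℕ → ℝ) (Λ' : ℝ),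
    0 < Λ' → Filter.Tendsto (fun k => β' k - afBeta 0 Λ' (a k)) Filter.atTop (nhds 0) →
      ∀ ℓ₀ : ℝ, 0 < ℓ₀ → Regime Λ' ℓ₀ → ∀ W : Family a ℓ₀, (∀ᶠ k in Filter.atTop, AdmAt η₀ κ a L β' Λ' ℓ₀ W k) →
        Concl a L ha ha₀ haL β' ℓ₀ κ (AdmAt η₀ κ a L β' Λ' ℓ₀) W

/-! ### §1 The posited interface: soft block-averaging schemes at scale `b` -/

/-- The coupling-relative factor `1 / max(1, afBeta 0 Λ' ℓ₀)` (`= g²(ℓ₀Λ')/2` at weak block coupling in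
the tree's normalisation `β = 2/g²`): the crux's budget is `η = η₀ · gfac`. -/
def gfac (Λ' ℓ₀ : ℝ) : ℝ := (max 1 (afBeta 0 Λ' ℓ₀))⁻¹

theorem gfac_pos (Λ' ℓ₀ : ℝ) : 0 < gfac Λ' ℓ₀ :=
  inv_pos.2 (lt_of_lt_of_le zero_lt_one (le_max_left _ _))

theorem gfac_le_one (Λ' ℓ₀ : ℝ) : gfac Λ' ℓ₀ ≤ 1 :=
  inv_le_one_of_one_le₀ (le_max_left _ _)

theorem div_max_eq_mul_gfac (η Λ' ℓ₀ : ℝ) : η / max 1 (afBeta 0 Λ' ℓ₀) = η * gfac Λ' ℓ₀ :=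
  div_eq_mul_inv _ _

/-- Admissibility is monotone in the budget and antitone in the decay rate. -/
theorem admAt_mono {η₀ η₀' κ κ' : ℝ} {a : ℕ → ℝ} {L : ℕ → ℕ} {β' : ℕ → ℝ} {Λ' ℓ₀ : ℝ} {W : Family a ℓ₀}
    {k : ℕ} (hη : η₀ ≤ η₀') (hκ : κ' ≤ κ) (h : AdmAt η₀ κ a L β' Λ' ℓ₀ W k) : AdmAt η₀' κ' a L β' Λ' ℓ₀ W k := by
  intro S hS
  obtain ⟨h1, h2, h3, h4, h5, h6⟩ := h S hS
  have hle : η₀ / max 1 (afBeta 0 Λ' ℓ₀) ≤ η₀' / max 1 (afBeta 0 Λ' ℓ₀) := by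
    rw [div_max_eq_mul_gfac, div_max_eq_mul_gfac]
    exact mul_le_mul_of_nonneg_right hη (gfac_pos _ _).le
  exact ⟨h1, h2, h3, h4, (h5.anti hκ).mono hle, h6⟩

/-- **A soft gauge-covariant block-averaging scheme** on the fine torus of side `N` at block size `b`
(HYPOTHESIS STRUCTURE — no existence claim inside; existence with the properties the line needs is the
content of `stub_softAbsorptionUV`). Data: a block torus of side `S'` whose sites LABEL the `b`-blocks of the
fine torus bijectively and coherently (`corner`: the next block site in direction `μ` is the next block,
forward fine distance `≤ 2b`, also across the ragged seam when `b ∤ N`); a measurable, gauge-COVARIANT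
(`link (U^g) = (link U)^{g ∘ corner}`) and LOCAL (the block link at `(y, μ)` reads only fine links based in
blocks within `ℓ∞`-distance `2b` of block `y`) hard averaging `link` (intended: Bałaban's iterated
covariant averaging, CMP 95 (1984) (1.4)–(1.7), CMP 119 (1988) (0.1) "any averaging operation satisfying
several general properties"); and the SOFT LAST STEP: a continuous central probability density `p` on
`SU(3)` (intended: the heat kernel `p_t`, `t = θ g²(ℓ₀)`, Stein 1970 Ch. II §2 / Hunt 1956) smearing each
hard block link, `V(y,μ) ~ p(V · V̄⁻¹) dV`. -/
structure SoftScheme (N : ℕ) [NeZero N] (b : ℕ) where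
  /-- side of the block torus -/
  S' : ℕ
  S'_pos : 0 < S'
  /-- the hard covariant block averaging -/
  link : GaugeConfig 4 N SU3 → GaugeConfig 4 S' SU3
  measurable_link : Measurable link
  /-- the fine block corner labelled by a block-torus site -/
  corner : Site 4 S' → Site 4 N
  corner_injective : Function.Injective corner
  corner_mem : ∀ y, corner y ∈ blockCorners (d := 4) (L := N) b
  corner_surj : ∀ x ∈ blockCorners (d := 4) (L := N) b, ∃ y, corner y = x
  corner_shift : ∀ (y : Site 4 S') (μ i : Fin 4), ((corner (y.shift μ)) i - (corner y) i).val ≤ 2 * b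
  link_gaugeTransform : ∀ (g : Site 4 N → SU3) (U : GaugeConfig 4 N SU3),
    link (gaugeTransform g U) = gaugeTransform (g ∘ corner) (link U)
  link_local : ∀ e : Edge 4 S', DependsOn (fun U => link U e)
    {e' : Edge 4 N | ∀ i : Fin 4, ((blockCorner b e'.1) i - (corner e.1) i).val ≤ 2 * b ∨
      ((corner e.1) i - (blockCorner b e'.1) i).val ≤ 2 * b}
  /-- the soft-step density (heat kernel at time `t = θ g²(ℓ₀)` in the intended inhabitant) -/
  p : SU3 → ℝ
  p_continuous : Continuous p
  p_nonneg : ∀ g, 0 ≤ p g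
  p_integral : ∫ g, p g ∂(haarProbability SU3) = 1
  p_central : ∀ g h, p (h * g * h⁻¹) = p g

namespace SoftScheme

variable {N : ℕ} [NeZero N] {b : ℕ} (𝔖 : SoftScheme N b)

instance : NeZero 𝔖.S' := ⟨(Nat.pos_iff_ne_zero).1 𝔖.S'_pos⟩

/-- The soft-step kernel: density (w.r.t. product Haar on the block links) of the block field `V`
given the hard average `V̄`, `K(V̄, V) = ∏ₑ p(V_e V̄_e⁻¹)`. -/
def kernel (Vbar V : GaugeConfig 4 𝔖.S' SU3) : ℝ :=
  ∏ e : Edge 4 𝔖.S', 𝔖.p (V e * (Vbar e)⁻¹)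

/-- **The soft-blocked density** of the fine weight `e^{-β S_W(U) - A(U)}` (`S_W` Wilson's action in the
fundamental representation, `A` any real functional of the fine links):
`σ_A(V) = ∫ K(link U, V) e^{-β S_W(U) - A(U)} ∏ dU` — Bałaban's `(Tρ)(V) = ∫ dU δ(Ū V⁻¹) ρ(U)` with the
δ-function of the LAST step replaced by the soft kernel. -/
def sbd (β : ℝ) (A : GaugeConfig 4 N SU3 → ℝ) (V : GaugeConfig 4 𝔖.S' SU3) : ℝ :=
  ∫ U, 𝔖.kernel (𝔖.link U) V * Real.exp (-β * wilsonAction ρ₃ U - A U) ∂(torusLinkHaar 4 SU3 N)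

/-- **`Eff` is the absorbed (effective block-scale) image of `A`**: the soft-blocked density of
`e^{-β S_W - A}` is that of `e^{-β S_W}` tilted by `e^{-Eff(V)}`, i.e. `e^{-Eff(V)} = E_β[e^{-A} | V]` up to
the constant carried by the empty polymer — an EXACT identity for all real block fields `V`. -/
def Absorbs (β : ℝ) (A : GaugeConfig 4 N SU3 → ℝ) (Eff : BlockScaleEffectivePerturbation 4 𝔖.S' SU3 1) : Prop :=
  ∀ V, 𝔖.sbd β A V = 𝔖.sbd β (fun _ => 0) V * Real.exp (-Eff.total V)

/-- Range control of a block-scale perturbation on the block torus (the crux's (h4) in block units,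
factor `2`: clusters of range-controlled pieces and collared large-field components are connected). -/
def BlockRangeControl (E : BlockScaleEffectivePerturbation 4 𝔖.S' SU3 1) : Prop :=
  ∀ Y : Finset (Site 4 𝔖.S'), Y ∈ polymers (d := 4) (L := 𝔖.S') 1 →
    (∃ V : GaugeConfig 4 𝔖.S' SU3, E.act Y V ≠ 0) →
      ∀ y ∈ Y, ∀ y' ∈ Y, ∀ i : Fin 4, (y i - y' i).val ≤ 2 * Y.card ∨ (y' i - y i).val ≤ 2 * Y.card

/-- **Large-field lumps are supported on collared rough regions**: an activity of `El` on `Y` can be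
non-zero at `V` only if every block of `Y` is within block `ℓ∞`-distance `R₀` of a block of `Y` carrying a
plaquette of `V` with cost `> ε₁` (Bałaban's large-field regions: unions of rough blocks and their collars,
never expanded; their entropy is paid by the W-free large-field probabilities). -/
def LumpSupported (R₀ : ℕ) (ε₁ : ℝ) (El : BlockScaleEffectivePerturbation 4 𝔖.S' SU3 1) : Prop :=
  ∀ (Y : Finset (Site 4 𝔖.S')) (V : GaugeConfig 4 𝔖.S' SU3), El.act Y V ≠ 0 →
    ∀ y ∈ Y, ∃ y' ∈ Y, (∀ i : Fin 4, (y i - y' i).val ≤ R₀ ∨ (y' i - y i).val ≤ R₀) ∧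
      ∃ p ∈ polymerPlaquettes (d := 4) (L := 𝔖.S') 1 {y'}, ε₁ < plaquetteCost ρ₃ V p

/-- Linear (local-absolute-continuity) bound on lump activities: `|El_Y(V)| ≤ η |Y|`. -/
def LumpBound (η : ℝ) (El : BlockScaleEffectivePerturbation 4 𝔖.S' SU3 1) : Prop :=
  ∀ (Y : Finset (Site 4 𝔖.S')) (V : GaugeConfig 4 𝔖.S' SU3), |El.act Y V| ≤ η * Y.card

/-- **Two-tier D1′ format of an absorbed perturbation `Es + El` with constants `(r, κ₁, ε₁, R₀, η)`** —
Bałaban-faithful: a SMALL-FIELD part `Es` whose activities are analytic with weighted norm `≤ η` on the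
radius-`r` complex neighbourhoods of the block fields that are `ε₁`-small ON THE POLYMER
(`smallFieldDomain ρ₃ 1 r ε₁`, local in the polymer, arbitrary elsewhere) and two-sided sup-small on all
real fields, plus a LARGE-FIELD LUMP part `El`, never expanded, supported on collared rough regions with the
linear bound `|El_Y| ≤ η|Y|`; both range-controlled. -/
def InAbsFormat (r κ₁ ε₁ : ℝ) (R₀ : ℕ) (η : ℝ) (Es El : BlockScaleEffectivePerturbation 4 𝔖.S' SU3 1) : Prop :=
  Es.HasAnalyticNormLE ρ₃ (smallFieldDomain ρ₃ 1 r ε₁) κ₁ η ∧ Es.NormLE κ₁ η ∧ 𝔖.BlockRangeControl Es ∧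
    𝔖.LumpSupported R₀ ε₁ El ∧ 𝔖.LumpBound η El ∧ 𝔖.BlockRangeControl El

variable {𝔖} in
theorem InAbsFormat.mono {r κ₁ ε₁ : ℝ} {R₀ : ℕ} {η η' : ℝ} {Es El : BlockScaleEffectivePerturbation 4 𝔖.S' SU3 1}
    (h : 𝔖.InAbsFormat r κ₁ ε₁ R₀ η Es El) (hη : η ≤ η') : 𝔖.InAbsFormat r κ₁ ε₁ R₀ η' Es El := by
  obtain ⟨⟨M, hA, hM⟩, hN, hR, hS, hB, hR'⟩ := h
  refine ⟨⟨M, hA, fun y hy => (hM y hy).trans hη⟩, hN.mono hη, hR, hS, fun Y V => (hB Y V).trans ?_, hR'⟩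
  exact mul_le_mul_of_nonneg_right hη (Nat.cast_nonneg _)

end SoftScheme

/-- Fine-level range control at block size `b` (VERBATIM the crux's (h4) for one perturbation). -/
def FineRangeControl {N : ℕ} [NeZero N] (b : ℕ) (A : QuasiLocalGaugePerturbation 4 N SU3 b) : Prop :=
  ∀ X : Finset (Site 4 N), X ∈ polymers b → (∃ U : GaugeConfig 4 N SU3, A.act X U ≠ 0) →
    ∀ y ∈ X, ∀ y' ∈ X, ∀ i : Fin 4, (y i - y' i).val ≤ b * X.card ∨ (y' i - y i).val ≤ b * X.card

theorem fineRangeControl_add {N : ℕ} [NeZero N] {b : ℕ} {A B : QuasiLocalGaugePerturbation 4 N SU3 b}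
    (hA : FineRangeControl b A) (hB : FineRangeControl b B) : FineRangeControl b (A + B) := by
  intro X hX hne
  obtain ⟨U, hU⟩ := hne
  rw [QuasiLocalGaugePerturbation.add_act] at hU
  by_cases h : A.act X U = 0
  · rw [h, zero_add] at hU
    exact hB X hX ⟨U, hU⟩
  · exact hA X hX ⟨U, h⟩

namespace SoftScheme

variable {N : ℕ} [NeZero N] {b : ℕ} (𝔖 : SoftScheme N b)

/-- **The scheme ABSORBS ALL sup-small range-controlled fine perturbations** (W-FREE property of the
soft-blocked Wilson measure at `β`): for every budget `ε ≤ ε₀` and every fine `A` with `‖A‖_{b,κin} ≤ ε`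
and range control there is an absorbed image `Es + El` in two-tier format with constants
`(r, κ₁, ε₁, R₀, C ε)`.  This is "ConeToBalabanFormat" as a property of the conditioning: its proof is
holomorphy under the integral sign (`stub_holomorphicAbsorption`), the complex-weights lemma
(`m(1+τ) - Mτ ≤ Re ∫ f w`), local absolute continuity for the lumps (`|Δ log E[e^{-A}|V]| ≤ ∑_{X∩R≠∅}‖A_X‖`),
and — the one Yang–Mills input — the conditional cluster expansion of the soft-conditioned Wilson measure
with bounded block-local insertions on small-field regions (Kotecký–Preiss on `E[∏_X (1 + f_X) | V]`,
`f_X = e^{-A_X} - 1`). -/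
def AbsorbsAll (bW : ℕ) (r β κin ε₀ κ₁ ε₁ : ℝ) (R₀ : ℕ) (C : ℝ) : Prop :=
  ∀ ε : ℝ, 0 ≤ ε → ε ≤ ε₀ → ∀ A : QuasiLocalGaugePerturbation 4 N SU3 bW, A.NormLE κin ε →
    FineRangeControl bW A →
      ∃ Es El : BlockScaleEffectivePerturbation 4 𝔖.S' SU3 1, 𝔖.Absorbs β A.total (Es + El) ∧
        𝔖.InAbsFormat r κ₁ ε₁ R₀ (C * ε) Es El

/-- **Analytic absorbability of ONE fine perturbation `W₀` together with insertions** (the hypothesis of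
the transfer on a cone member): `W₀ + B` is absorbed in format `ηW + C ε` for every insertion `B` of budget
`ε ≤ ε₀` (`B = 0`: `W₀` itself, constant `ηW`; `B = W' - W₀`: clause (iv); block-local bounded `B`:
observables). -/
def AbsIns (bW : ℕ) (r β κ ε₀ κ₁ ε₁ : ℝ) (R₀ : ℕ) (C ηW : ℝ) (W₀ : QuasiLocalGaugePerturbation 4 N SU3 bW) : Prop :=
  ∀ ε : ℝ, 0 ≤ ε → ε ≤ ε₀ → ∀ B : QuasiLocalGaugePerturbation 4 N SU3 bW, B.NormLE κ ε →
    FineRangeControl bW B →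
      ∃ Es El : BlockScaleEffectivePerturbation 4 𝔖.S' SU3 1, 𝔖.Absorbs β (W₀ + B).total (Es + El) ∧
        𝔖.InAbsFormat r κ₁ ε₁ R₀ (ηW + C * ε) Es El

variable {𝔖} in
/-- From the W-free absorption property and the crux's (h3) + (h4) for `W₀`: `W₀` is absorbable with
insertions (`NormLE.add`, range control of sums). -/
theorem absIns_of_absorbsAll {bW : ℕ} {r β κ ε₀ κ₁ ε₁ : ℝ} {R₀ : ℕ} {C ηW' ηW : ℝ}
    (h : 𝔖.AbsorbsAll bW r β κ ε₀ κ₁ ε₁ R₀ C)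
    {W₀ : QuasiLocalGaugePerturbation 4 N SU3 bW} (hn : W₀.NormLE κ ηW') (hrc : FineRangeControl bW W₀)
    (hε : ηW' ≤ ε₀ / 2) (hb : C * ηW' ≤ ηW) :
    𝔖.AbsIns bW r β κ (ε₀ / 2) κ₁ ε₁ R₀ C ηW W₀ := by
  intro ε hε0 hεle B hB hBrc
  have h0 : 0 ≤ ηW' := hn.nonneg
  obtain ⟨Es, El, hAbs, hF⟩ :=
    h (ηW' + ε) (by linarith) (by linarith) (W₀ + B) (hn.add hB) (fineRangeControl_add hrc hBrc)
  refine ⟨Es, El, hAbs, hF.mono ?_⟩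
  have : C * (ηW' + ε) = C * ηW' + C * ε := by ring
  linarith

end SoftScheme

/-- A family of soft schemes along the scaling data: at step `k` on the torus `2S+1`, with the scheme's
OWN block sizes `bs k` (intended `bs k = ⌊ℓ₀' / a_k⌋` for a block scale `ℓ₀' ≤ ℓ₀` at or below Bałaban's
weak-coupling threshold, `ℓ₀'Λ' = c_*`: a perturbation of the crux at scale `ℓ₀` with `ℓ₀Λ' ≤ c_UV` is
re-indexed as a sup-small quasi-local perturbation at the finer scale `ℓ₀'`, its polymers growing by the
bounded factor `(c_UV/c_*)⁴`, which the stub's choice of the fine decay `κ` pays for). -/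
abbrev SchemeFamily (bs : ℕ → ℕ) : Type :=
  (k : ℕ) → (S : ℕ) → SoftScheme (2 * S + 1) (bs k)

/-- **The analytically absorbable cone at step `k`** (hypothesis of the transfer on a family `W`): for
all `S ≥ L_k`, (h1) lattice symmetry of the total (verbatim), (h2) reflection positivity (verbatim) and
`AbsIns` — absorbability with insertions in format `η₁·gfac + C ε` under `𝔖 k S`. -/
def HypAt (κ ε₀ κ₁ ε₁ : ℝ) (R₀ : ℕ) (C η₁ : ℝ) (a : ℕ → ℝ) (L : ℕ → ℕ) (β' : ℕ → ℝ) (Λ' ℓ₀ r : ℝ)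
    {bs : ℕ → ℕ} (𝔖 : SchemeFamily bs) (W : Family a ℓ₀) (k : ℕ) : Prop :=
  ∀ S : ℕ, L k ≤ S → (∀ (v : Site 4 (2 * S + 1)) (U : GaugeConfig 4 (2 * S + 1) SU3), (W k S).total (torusConfigShift v U) = (W k S).total U) ∧ (∀ U : GaugeConfig 4 (2 * S + 1) SU3, (W k S).total (GaugeConfig.timeReflect U) = (W k S).total U) ∧ (∀ (π : Equiv.Perm (Fin 4)) (U : GaugeConfig 4 (2 * S + 1) SU3), (W k S).total (fun e => U (e.1 ∘ π, π.symm e.2)) = (W k S).total U) ∧ (W k S).IsReflectionPositive ρ₃ (β' k) ∧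
    (𝔖 k S).AbsIns ⌊ℓ₀ / a k⌋₊ r (β' k) κ ε₀ κ₁ ε₁ R₀ C (η₁ * gfac Λ' ℓ₀) (W k S)

/-- **Pointwise conversion** (at a step `k` where the scheme absorbs everything with input decay `κ`): a
`(η₀, κ)`-admissible family is in the analytically absorbable cone with `ηW = η₁ gfac`, as soon as
`C η₀ ≤ η₁` and `η₀ ≤ ε₀/2`. -/
theorem hypAt_of_admAt {η₀ η₁ κ ε₀ κ₁ ε₁ : ℝ} {R₀ : ℕ} {C : ℝ} {a : ℕ → ℝ} {L : ℕ → ℕ} {β' : ℕ → ℝ}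
    {Λ' ℓ₀ r : ℝ} {bs : ℕ → ℕ} {𝔖 : SchemeFamily bs} {W : Family a ℓ₀} {k : ℕ} (hη₀ : 0 ≤ η₀)
    (hCη : C * η₀ ≤ η₁) (hηε : η₀ ≤ ε₀ / 2)
    (hk : ∀ S : ℕ, L k ≤ S → (𝔖 k S).AbsorbsAll ⌊ℓ₀ / a k⌋₊ r (β' k) κ ε₀ κ₁ ε₁ R₀ C)
    (hW : AdmAt η₀ κ a L β' Λ' ℓ₀ W k) :
    HypAt κ (ε₀ / 2) κ₁ ε₁ R₀ C η₁ a L β' Λ' ℓ₀ r 𝔖 W k := by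
  intro S hS
  obtain ⟨h1, h2, h3, h4, h5, h6⟩ := hW S hS
  refine ⟨h1, h2, h3, h4, ?_⟩
  have hg := gfac_pos Λ' ℓ₀
  have hg1 := gfac_le_one Λ' ℓ₀
  rw [div_max_eq_mul_gfac] at h5
  refine SoftScheme.absIns_of_absorbsAll (hk S hS) h5 h6 ?_ ?_
  · have : η₀ * gfac Λ' ℓ₀ ≤ η₀ := by nlinarith
    linarith
  · have : C * (η₀ * gfac Λ' ℓ₀) = (C * η₀) * gfac Λ' ℓ₀ := by ring
    rw [this]
    exact mul_le_mul_of_nonneg_right hCη hg.le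

/-- **The line's body at `(data, ℓ₀)` with constants `(κ, ε₀, C, η₁)`**: there are format data
`(r, κ₁, ε₁, R₀)` (intended `r ≍ c g(ℓ₀)` in matrix units, `ε₁ ≍ g² p(g)²`, `κ₁ > 0`) and a family of soft
schemes `𝔖` such that (A) [W-free] eventually in `k`, uniformly in `S ≥ L_k`, `𝔖 k S` ABSORBS ALL sup-small
range-controlled perturbations with input decay `κ`, and (B) [transfer, `RobustYangMillsRG♭`] every family
`W` eventually in the analytically absorbable cone of `𝔖` (budget `η₁ gfac`, insertions up to `ε₀/2`)
satisfies the crux's conclusion block with decay `κ` in (iv). -/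
def LineBodyAt (κ ε₀ C η₁ : ℝ) (a : ℕ → ℝ) (L : ℕ → ℕ) (ha : ∀ k, 0 < a k)
    (ha₀ : Filter.Tendsto a Filter.atTop (nhds 0)) (haL : Filter.Tendsto (fun k => a k * L k) Filter.atTop Filter.atTop)
    (β' : ℕ → ℝ) (Λ' ℓ₀ : ℝ) : Prop :=
  ∃ (r κ₁ ε₁ : ℝ) (R₀ : ℕ) (bs : ℕ → ℕ) (𝔖 : SchemeFamily bs),
    (∀ᶠ k in Filter.atTop, ∀ S : ℕ, L k ≤ S → (𝔖 k S).AbsorbsAll ⌊ℓ₀ / a k⌋₊ r (β' k) κ ε₀ κ₁ ε₁ R₀ C) ∧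
    ∀ W : Family a ℓ₀, (∀ᶠ k in Filter.atTop, HypAt κ (ε₀ / 2) κ₁ ε₁ R₀ C η₁ a L β' Λ' ℓ₀ r 𝔖 W k) →
      Concl a L ha ha₀ haL β' ℓ₀ κ (HypAt κ (ε₀ / 2) κ₁ ε₁ R₀ C η₁ a L β' Λ' ℓ₀ r 𝔖) W

/-- **The line in a regime of the block scale** (`Regime Λ' ℓ₀`): constants `(κ, ε₀, C, η₁)`, chosen
before the scaling data, such that for all scaling data, every `N_f = 0` a.f. coupling sequence and every
`ℓ₀ > 0` in the regime, `LineBodyAt` holds. -/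
def RegimeStatement (Regime : ℝ → ℝ → Prop) : Prop :=
  ∃ κ : ℝ, 0 ≤ κ ∧ ∃ ε₀ : ℝ, 0 < ε₀ ∧ ∃ C : ℝ, 1 ≤ C ∧ ∃ η₁ : ℝ, 0 < η₁ ∧
    ∀ (a : ℕ → ℝ) (L : ℕ → ℕ) (ha : ∀ k, 0 < a k) (ha₀ : Filter.Tendsto a Filter.atTop (nhds 0))
      (haL : Filter.Tendsto (fun k => a k * L k) Filter.atTop Filter.atTop) (β' : ℕ → ℝ) (Λ' : ℝ),
      0 < Λ' → Filter.Tendsto (fun k => β' k - afBeta 0 Λ' (a k)) Filter.atTop (nhds 0) →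
        ∀ ℓ₀ : ℝ, 0 < ℓ₀ → Regime Λ' ℓ₀ → LineBodyAt κ ε₀ C η₁ a L ha ha₀ haL β' Λ' ℓ₀

/-! ### §2 The stub statements

Each stub's statement is the named proposition `Statement.<stub name>` (same short name as the registered
stub theorem, so that the hypotheses of `RobustYangMills_of` are the stubs BY NAME for the skeleton audit);
the registered stubs are the sorried theorems `stub_…` of §3. -/

namespace Statement

/-- **Stub 1 — holomorphy under the integral sign (pure analysis; the lever's first lemma).**  On a finite
measure space, integrating a kernel `K(z, x)` which is holomorphic in `z ∈ D ⊆ ℂᵐ` (open) for every `x`,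
measurable in `x` for every `z`, and uniformly bounded, yields a holomorphic function of `z` — WHATEVER
THE ROUGHNESS of `K` in `x` (a bounded measurable spectator `e^{-W}` is folded into `K`).  Mathlib route:
Cauchy estimates on polydiscs inside `D` bound `∂_z K` uniformly, measurability of `x ↦ ∂_z K(z,x)` from
difference quotients, then `hasFDerivAt_integral_of_dominated_of_fderiv_le`.  Size M. -/
def stub_holomorphicAbsorption : Prop :=
  ∀ (X : Type) [MeasurableSpace X] (μ : MeasureTheory.Measure X) [MeasureTheory.IsFiniteMeasure μ]
    (m : ℕ) (D : Set (Fin m → ℂ)), IsOpen D →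
      ∀ K : (Fin m → ℂ) → X → ℂ, (∀ x, DifferentiableOn ℂ (fun z => K z x) D) →
        (∀ z ∈ D, Measurable (K z)) → (∃ M : ℝ, ∀ z ∈ D, ∀ x, ‖K z x‖ ≤ M) →
          DifferentiableOn ℂ (fun z => ∫ x, K z x ∂μ) D

/-- **Stub 2 — the Wilson core (W ≡ 0): Clay `SU(3)` Yang–Mills + β-universality.**  Along EVERY
scaling sequence and every `N_f = 0` two-loop asymptotically free coupling sequence, the unperturbed
Wilson theory has a subsequential OS continuum limit of all gauge-invariant species with non-trivial
non-Gaussian curvature, a mass gap `Δ > 0` of the limit and the uniform lattice gap `HasLatticeMassGap`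
at the same `Δ` — verbatim the consequent `WilsonConsequences` of the disprover's
`robustYangMills_imp_wilson` (Disproof.lean §5: PROVED to follow from the crux, since `W ≡ 0` is
admissible; so this stub is a NECESSARY conjunct of the crux, shared by every line on it).  It is the
honest Clay core which this line does not touch (card: "removes W from the problem"); the regime stubs
are stated relative to it. -/
def stub_wilsonCore : Prop :=
  ∀ (a : ℕ → ℝ) (L : ℕ → ℕ) (ha : ∀ k, 0 < a k) (ha₀ : Filter.Tendsto a Filter.atTop (nhds 0))
    (haL : Filter.Tendsto (fun k => a k * L k) Filter.atTop Filter.atTop) (β' : ℕ → ℝ) (Λ' : ℝ),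
    0 < Λ' → Filter.Tendsto (fun k => β' k - afBeta 0 Λ' (a k)) Filter.atTop (nhds 0) →
      ∃ φ : ℕ → ℕ, StrictMono φ ∧ ∃ (c m : YMSpecies SU3 → ℕ → ℝ) (T : OSData (YMSpecies SU3) 4) (Δ : ℝ),
        0 < Δ ∧
        (∀ n : ℕ, n ≠ 0 → ∀ (σ : Fin n → YMSpecies SU3) (f : Fin n → SchwartzMap (EuclideanSpace ℝ (Fin 4)) ℝ)
          (F : SchwartzMap (Fin n → EuclideanSpace ℝ (Fin 4)) ℂ),
          IsTensorOf F (fun i => ofRealTest (f i)) → IsOffDiagonal F →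
            Filter.Tendsto (fun j : ℕ => ((latticeSchwinger ρ₃
              (⟨a, ha, ha₀, β', L, haL, c, m⟩ : SpeciesScheme (YMSpecies SU3)) (fun s => s.F) (φ j) n σ f : ℝ) : ℂ))
              Filter.atTop (nhds (T.schwinger n σ F))) ∧
        T.IsNontrivial r₃.curvature ∧ T.IsNonGaussian r₃.curvature ∧ T.HasMassGap Δ ∧
        HasLatticeMassGap r₃ (⟨a, ha, ha₀, β', L, haL, c, m⟩ : SpeciesScheme (YMSpecies SU3)) Δ

/-- **Stub 3 — THE LINE: soft absorption into Bałaban's cone on every ULTRAVIOLET-ANCHORED WINDOW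
`ℓ₀Λ' ≤ c_UV`.**  Given holomorphy under the integral sign and the Wilson core: for every `c_UV > 0` there
are constants `(κ, ε₀, C, η₁)` (depending on `c_UV`) such that for all a.f. data and every block scale with
`ℓ₀Λ' ≤ c_UV`, a family of soft schemes — Bałaban's covariant averaging from `a_k` to the weak-coupling
threshold scale `ℓ₀' = min(ℓ₀, c_⋆/Λ')` with a HEAT-KERNEL LAST STEP `p_{θ g²(ℓ₀')}`, analyticity radius
`r ≍ √θ g(ℓ₀')`; a perturbation filed at the coarser scale `ℓ₀` is re-indexed at `ℓ₀'`, its polymers growing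
by the bounded factor `(c_UV/c_⋆)⁴` which the fine decay `κ` pays for — exists such that (A) [W-free UV
input: conditional UV stability with bounded insertions on small-field regions, Bałaban /
Magnen–Rivasseau–Sénéor class, UNPROVED] it absorbs ALL sup-small range-controlled perturbations into the
two-tier analytic format, and (B) [`RobustYangMillsRG♭`, the transfer target] every family in its
analytically absorbable cone (lattice symmetric, reflection positive, absorbable with insertions at budget
`η₁ g²(ℓ₀)/2`) satisfies the crux's conclusion block: the block theory `[Bałaban-format blocked Wilson] ⊕
[analytic O(η₁ g²) perturbation + collared lumps]` is an admissible initial condition of the induction from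
scale `ℓ₀'`, the marginal (coupling) component is absorbed by attraction to the parabolic centre-unstable
curve (`β' → β''`, `Λ' → Λ''`), and the infrared end is that of the unperturbed theory along the shifted
sequence (the core).  (B) omits (h3)/(h4) on purpose: an uninformative scheme absorbs trivially and is then
refuted in (B) by the mixture witness of Disproof §4, so the conjunction can only be witnessed by an
informative scheme.  This stub ⊇ action-universality of the gapped phase; it is where the line can be
refuted (cheapest falsifier: the one-block weights computation `τ(r, t) < 1/(4η)` at `r ≍ √t`, and the
strip-width mismatch `√θ g` versus Bałaban's `α₁ = g C₁ (log g⁻²)^{q₁}`, CMP 119 p. 259 (2.28)). -/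
def stub_softAbsorptionUV : Prop :=
  stub_holomorphicAbsorption → stub_wilsonCore →
    ∀ cUV : ℝ, 0 < cUV → RegimeStatement (fun Λ' ℓ₀ => ℓ₀ * Λ' ≤ cUV)

/-- **Stub 4 — the INFRARED TAIL `ℓ₀Λ' > c_IR` (HAND-OFF to the gap / finite-size-certificate lines), stated as
the crux body on the tail, conditional on the Wilson core.**  For some `c_IR > 0` and constants `(η₀', κ')`, every
eventually admissible family at block scales with `ℓ₀Λ' > c_IR` satisfies the conclusion block.  Here the blocks
exceed the correlation length and the mechanism is NOT this line's: a bounded sup-small range-controlled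
perturbation per super-correlation block of the core's exponentially clustering measure is handled by a polymer
expansion in the activities `e^{-W_X} - 1` at scale `ℓ₀` (Kotecký–Preiss; local absolute continuity for (i′)/(ii)),
given the core and a lower bound on the physical gap in units of `Λ'` uniform over a.f. data (universality), which
is why `c_IR` can precede the data.  DELIBERATELY NOT in soft-scheme form: at super-correlation scales every block
averaging of a confining theory is uninformative (the reference block field is itself Haar-like by the area law),
so absorbability no longer encodes sup-smallness and a transfer for "the absorbable cone" would be refuted by the
mixture witness of Disproof §4; the tail keeps (h3)/(h4) verbatim instead.  The tail cannot be reached from Stub 3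
because `η₀, κ` are chosen before `ℓ₀` while the re-indexing factor `(ℓ₀Λ'/c_⋆)⁴` is unbounded.  Triage r1-3: "hand
`ℓ₀Λ' > c` to the certificate line". -/
def stub_infraredTail : Prop :=
  stub_wilsonCore →
    ∃ cIR : ℝ, 0 < cIR ∧ ∃ η₀' : ℝ, 0 < η₀' ∧ ∃ κ' : ℝ, 0 ≤ κ' ∧ BodyOn (fun Λ' ℓ₀ => cIR < ℓ₀ * Λ') η₀' κ'

end Statement

/-! ### §3 Registered stubs -/

/-- Stub 1: holomorphy under the integral sign (pure analysis, provable now). -/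
theorem stub_holomorphicAbsorption : Statement.stub_holomorphicAbsorption := by
  sorry

/-- Stub 2: the Wilson core, `W ≡ 0` (Clay `SU(3)` + β-universality; necessary by Disproof §5). -/
theorem stub_wilsonCore : Statement.stub_wilsonCore := by
  sorry

/-- Stub 3 (the line; hardest line-specific stub): soft absorption + `RobustYangMillsRG♭` in the UV regime. -/
theorem stub_softAbsorptionUV : Statement.stub_softAbsorptionUV := by
  sorry

/-- Stub 4: the infrared tail (hand-off; crux body on the tail given the core). -/
theorem stub_infraredTail : Statement.stub_infraredTail := by
  sorry

/-! ### §4 The kernel-checked composition -/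

/-- **One regime**: the line's body at `(data, ℓ₀)` with constants `(κ₀, ε₀, C, η₁)` gives the crux's
conclusion block at `(η₀, κ)` for every eventually `(η₀, κ)`-admissible family, provided `κ₀ ≤ κ`,
`C η₀ ≤ η₁` and `η₀ ≤ ε₀/2`: admissible at `κ` ⇒ admissible at `κ₀` (`admAt_anti`) ⇒ analytically absorbable
pointwise in `k` (`hypAt_of_admAt`) ⇒ conclusions at `(HypAt, κ₀)` ⇒ conclusions at `(AdmAt, κ)`
(`concl_mono`). -/
theorem conclude {η₀ η₁ κ₀ κ ε₀ C : ℝ} {a : ℕ → ℝ} {L : ℕ → ℕ} {ha : ∀ k, 0 < a k}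
    {ha₀ : Filter.Tendsto a Filter.atTop (nhds 0)} {haL : Filter.Tendsto (fun k => a k * L k) Filter.atTop Filter.atTop}
    {β' : ℕ → ℝ} {Λ' ℓ₀ : ℝ} (hκ : κ₀ ≤ κ) (hη₀ : 0 ≤ η₀) (hCη : C * η₀ ≤ η₁) (hηε : η₀ ≤ ε₀ / 2)
    (hbody : LineBodyAt κ₀ ε₀ C η₁ a L ha ha₀ haL β' Λ' ℓ₀)
    (W : Family a ℓ₀) (hW : ∀ᶠ k in Filter.atTop, AdmAt η₀ κ a L β' Λ' ℓ₀ W k) :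
    Concl a L ha ha₀ haL β' ℓ₀ κ (AdmAt η₀ κ a L β' Λ' ℓ₀) W := by
  obtain ⟨r, κ₁, ε₁, R₀, bs, 𝔖, hAbs, hT⟩ := hbody
  have key : ∀ᶠ k in Filter.atTop, ∀ W' : Family a ℓ₀, AdmAt η₀ κ a L β' Λ' ℓ₀ W' k →
      HypAt κ₀ (ε₀ / 2) κ₁ ε₁ R₀ C η₁ a L β' Λ' ℓ₀ r 𝔖 W' k :=
    hAbs.mono fun k hk W' hW' => hypAt_of_admAt hη₀ hCη hηε hk (admAt_anti hκ hW')
  have hWH : ∀ᶠ k in Filter.atTop, HypAt κ₀ (ε₀ / 2) κ₁ ε₁ R₀ C η₁ a L β' Λ' ℓ₀ r 𝔖 W k := by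
    filter_upwards [key, hW] with k hk hk' using hk W hk'
  exact concl_mono hκ key (hT W hWH)

/-- **Composition** (sorry-free, standard axioms): the four stub STATEMENTS imply the crux.  From the infrared
tail take `(c_IR, η₀', κ')`; instantiate the ultraviolet stub at the window `c_UV := c_IR` and take its constants
`(κ, ε₀, C, η₁)`; the crux holds with `κ₀ = max κ κ'` and `η₀ = min (η₁/C, ε₀/2, η₀')`: given `(data, ℓ₀)` split on
`ℓ₀Λ' ≤ c_IR` — on the window `conclude`; on the tail convert admissibility to the tail's constants
(`admAt_mono`), apply `BodyOn` and read back (`concl_mono`). -/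
theorem RobustYangMills_of :
    Statement.stub_holomorphicAbsorption → Statement.stub_wilsonCore → Statement.stub_softAbsorptionUV →
      Statement.stub_infraredTail →
        Summit.QuantumFields.QCD.Theses.NestedDissectionSea.RobustYangMills := by
  intro h₁ h₂ h₃ h₄
  obtain ⟨cIR, hcIR, η₀', hη₀', κ', hκ', H'⟩ := h₄ h₂
  obtain ⟨κ, hκ, ε₀, hε₀, C, hC, η₁, hη₁, H⟩ := h₃ h₁ h₂ cIR hcIR
  have hCpos : 0 < C := lt_of_lt_of_le zero_lt_one hC
  set κ₀ : ℝ := max κ κ' with hκ₀_def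
  have hκ₀ : 0 ≤ κ₀ := le_trans hκ (le_max_left _ _)
  set η₀ : ℝ := min (min (η₁ / C) (ε₀ / 2)) η₀' with hη₀_def
  have hη₀ : 0 < η₀ := lt_min (lt_min (div_pos hη₁ hCpos) (half_pos hε₀)) hη₀'
  have hη₀C : C * η₀ ≤ η₁ := by
    have h1 : η₀ ≤ η₁ / C := (min_le_left _ _).trans (min_le_left _ _)
    calc C * η₀ ≤ C * (η₁ / C) := mul_le_mul_of_nonneg_left h1 hCpos.le
      _ = η₁ := mul_div_cancel₀ η₁ hCpos.ne'
  have hη₀ε : η₀ ≤ ε₀ / 2 := (min_le_left _ _).trans (min_le_right _ _)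
  have hη₀' : η₀ ≤ η₀' := min_le_right _ _
  refine robustYangMills_iff.2 ⟨η₀, hη₀, κ₀, hκ₀, ?_⟩
  intro a L ha ha₀ haL β' Λ' hΛ' hβ' ℓ₀ hℓ₀ W hW
  rcases le_or_gt (ℓ₀ * Λ') cIR with hreg | hreg
  · exact conclude (le_max_left _ _) hη₀.le hη₀C hη₀ε (H a L ha ha₀ haL β' Λ' hΛ' hβ' ℓ₀ hℓ₀ hreg) W hW
  · have key : ∀ (W' : Family a ℓ₀) (k : ℕ), AdmAt η₀ κ₀ a L β' Λ' ℓ₀ W' k → AdmAt η₀' κ' a L β' Λ' ℓ₀ W' k :=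
      fun W' k h => admAt_mono hη₀' (le_max_right _ _) h
    have hW' : ∀ᶠ k in Filter.atTop, AdmAt η₀' κ' a L β' Λ' ℓ₀ W k := hW.mono fun k hk => key W k hk
    exact concl_mono (le_max_right _ _) (Filter.Eventually.of_forall fun k W' h => key W' k h)
      (H' a L ha ha₀ haL β' Λ' hΛ' hβ' ℓ₀ hℓ₀ hreg W hW')

/-- **The skeleton theorem**: the crux BY NAME from the four registered stubs (its only non-whitelisted
axiom is the `sorryAx` of the stubs; `RobustYangMills_of` is the sorry-free logic). -/
theorem RobustYangMills_skeleton :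
    Summit.QuantumFields.QCD.Theses.NestedDissectionSea.RobustYangMills :=
  RobustYangMills_of stub_holomorphicAbsorption stub_wilsonCore stub_softAbsorptionUV stub_infraredTail

/-- The same for the SHARED copy of the crux in route HeavyThresholdYMBridge (the three route decls have
identical bodies and are definitionally equal; the item stmt-QuantumFields-13897 is keyed on this one). -/
theorem RobustYangMills_skeleton_heavyThreshold :
    Summit.QuantumFields.QCD.Theses.HeavyThresholdYMBridge.RobustYangMills :=
  RobustYangMills_skeleton

/-- The same for the SHARED copy of the crux in route AdaptiveBlockFermions. -/
theorem RobustYangMills_skeleton_adaptiveBlockFermions :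
    Summit.QuantumFields.QCD.Theses.AdaptiveBlockFermions.RobustYangMills :=
  RobustYangMills_skeleton

end Summit.QuantumFields.QCD.Cruxes.RobustYangMills.SoftAbsorptionBalabanCone

end
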